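import Literature.Geometry.Riemannian.ChangGurskyYangEuler
import Literature.Geometry.Riemannian.ChangGurskyYangRegularity
import Literature.Geometry.Riemannian.RoundSphereVolume
import Literature.Geometry.Lorentzian.GreenIdentity
import HarnessLib

/-!
# The `Q`-curvature of a Riemannian `4`-manifold: (1.11) `Q = ½ σ₂(A) − (1/12) ΔR` and `∫_M Q dV = ½ ∫_M σ₂(A) dV`

Fifth companion ("Proofs") file of `Literature/Geometry/Riemannian/ChangGurskyYang.lean` (the
named fact `changGurskyYang_sphere_four`, Chang–Gursky–Yang 2003, Thm. A, simply connected
`scal > 0` case), formalizing the curvature quantity that drives §1 of the paper (the existence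
theory behind Thm. 1.4, the last analytic hypothesis of the reductions in
`ChangGurskyYangEuler.lean`). Chang–Gursky–Yang 2003, p. 113: the functional
`II[ω] = ∫ ω P₀ ω + 4 ∫ Q₀ ω − (∫ Q₀) log ⨍ e^{4ω}` is built on "the Paneitz operator `P`" and
"`Q`, the fourth order curvature invariant: `Q = (1/12)(−ΔR + ¼R² − 3|E|²)`. Thus
(1.11) `Q = ½ σ₂(A) + (1/12)(−ΔR)`", with `E = Ric − ¼Rg`, `σ₂(A) = −½|E|² + R²/24` (§2,
p. 121) and `Δ = tr ∇²` the Laplace–Beltrami operator. Here, in the tree's vocabulary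
(`dalembertian` = `tr_g Hess`, `LeviCivita.lean`; `tracelessRicciNormSq` = `|E|²` and
`sigma2WeylSchouten` = `σ₂(A)`, `ChangGurskyYangProofs.lean`):

* `PseudoRiemannianMetric.qCurvature g x = (1/12)(−Δ_g R (x) + ¼ R(x)² − 3 |E|²(x))` — the
  printed definition;
* `qCurvature_eq_sigma2WeylSchouten` — **(1.11)** `Q = ½ σ₂(A) − (1/12) Δ R` pointwise on a
  `4`-dimensional model (`sigma2WeylSchouten_eq`);
* `Δ_g c = 0` for a constant (private copies of the helpers of `Lorentzian/BlackHoles.lean`),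
  whence `HasConstantSectionalCurvatureWith.qCurvature_eq`: **`Q = 3K²`** for constant sectional
  curvature `K` in dimension `4` (`R ≡ 12K`, `E = 0`, `ΔR = 0`), and
  `qCurvature_roundMetric_sphere_four`: `Q ≡ 3` on the round unit `S⁴`;
* `continuous_qCurvature` — `Q` is continuous for a `C^∞` Riemannian metric on a boundaryless
  `4`-dimensional model (`continuous_dalembertian`, `contMDiff_scalarCurvature`,
  `continuous_tracelessRicciNormSq`);
* `integral_qCurvature_eq` — on a CLOSED Riemannian `4`-manifold (modelled on `ℝ⁴`),
  **`∫_M Q dV = ½ ∫_M σ₂(A) dV`** (`= ½ sigma2WeylSchoutenIntegral`), because `∫_M ΔR dV = 0`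
  (`integral_dalembertian_eq_zero`, Green's identity of `Lorentzian/GreenIdentity.lean`; Lee
  2018, Problem 2-23 (c)) — the identity by which `∫ Q dv` is a conformal invariant together
  with `∫ σ₂(A) dv` (p. 111; cf. "the conformal invariant `κ`" of (1.12), p. 114);
* `chernGaussBonnet_iff_qCurvature` — consequently the Chern–Gauss–Bonnet formula (1.1)
  `8π² χ = ¼ ∫|W|² dV + ∫ σ₂(A) dV` is equivalent to its `Q`-curvature form
  **`4π² χ = ⅛ ∫|W|² dV + ∫ Q dV`** (any real `χ`), and `integral_qCurvature_roundMetric_sphere_four`: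
  on the round `S⁴`, `∫ Q dV = 3 · 8π²/3 = 8π² = 4π² χ(S⁴)` (`Vol(S⁴) = 8π²/3`,
  `RoundSphereVolume.lean`; `χ(S⁴) = relEuler ℤ ℤ S⁴ ∅ = 2`, `TrisectionEulerProofs.lean`).

* `changGurskyYang_kappa_eq_zero`, `changGurskyYang_kappa_lt` — the first step of the proof of
  Thm. 1.4 (pp. 114–116): with `γ̃₁ = −½(∫σ₂(A₀) − (α/4)∫|W₀|²)/∫|η|₀²`, `γ₁ = −α/8`, `γ₂ = 1`
  the conformal invariant `κ = γ̃₁∫|η|₀² + γ₁∫|W₀|² + γ₂∫Q₀` of (1.12) VANISHES (by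
  `∫Q = ½∫σ₂(A)`), so the hypothesis `κ < γ₂ 8π²` of Thm. 1.5 holds;
* `changGurskyYang_sphere_four_of_chernGaussBonnetQ_of_margerin_of_thm14` — the fact from
  Margerin's theorem, Thm. 1.4 and the Chern–Gauss–Bonnet formula in `Q`-curvature form
  `4π² χ(M) = ⅛ ∫|W|² dV + ∫ Q dV` (through the reduction of `ChangGurskyYangEuler.lean`).

Everything is proved; one explicit real-valued definition (`qCurvature`), no named fact.

## References

* S.-Y. A. Chang, M. J. Gursky, P. C. Yang, *A conformally invariant sphere theorem in four
  dimensions*, Publ. Math. IHÉS 98 (2003) 105–143, §1, p. 113 (Paneitz operator, `Q`, (1.11)),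
  (1.12) p. 114, (1.1) p. 111, §2 p. 121. [ChangGurskyYang2003]
* J. M. Lee, *Introduction to Riemannian Manifolds*, 2nd ed., Springer 2018, Problem 2-23 (c)
  (`∫_M Δu dV_g = 0` on a closed manifold). [Lee2018]
* B. O'Neill, *Semi-Riemannian geometry*, Academic Press 1983, Ch. 3, Def. 3.48–3.50 (Hessian,
  Laplacian). [ONeill1983]
-/

noncomputable section

open Bundle Set Function Filter Manifold MeasureTheory Module
open scoped Manifold ContDiff Topology ENNReal

namespace Literature.Geometry.Riemannian

open Literature.Geometry.Lorentzian (PseudoRiemannianMetric riemannianMeasure)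
open Literature.Geometry.Lorentzian.PseudoRiemannianMetric
open Literature.Geometry.Lorentzian

/-! ### The Laplacian of a constant vanishes -/

section Const

variable {E : Type*} [NormedAddCommGroup E] [NormedSpace ℝ E] {H : Type*} [TopologicalSpace H]
  {I : ModelWithCorners ℝ E H} {M : Type*} [TopologicalSpace M] [ChartedSpace H M]
  [IsManifold I ∞ M] {n : ℕ∞ω} [Fact (1 ≤ n)] [FiniteDimensional ℝ E]
  (g : PseudoRiemannianMetric I n E (TangentSpace I : M → Type _)) [g.HasLeviCivita]

omit [IsManifold I ∞ M] [Fact (1 ≤ n)] [FiniteDimensional ℝ E] [g.HasLeviCivita] in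
/-- The differential (`mvfderiv`) of a constant function vanishes (local copy of the helper of
`Lorentzian/BlackHoles.lean`, kept private to spare the import). [folklore] -/
private theorem mvfderiv_const_aux (c : ℝ) (x : M) : mvfderiv I (fun _ : M ↦ c) x = 0 := by
  have h0 : mfderiv I 𝓘(ℝ, ℝ) (fun _ : M ↦ c) x = 0 := mfderiv_const
  ext v
  simp [mvfderiv, h0]

omit [Fact (1 ≤ n)] [FiniteDimensional ℝ E] in
/-- The bare Hessian operation of a constant vanishes: both terms of `X(Yc) − (∇_X Y)c` are
derivatives of constants (O'Neill 1983, Ch. 3, Def. 3.48). [cite: ONeill1983, Ch. 3, Def. 3.48] -/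
private theorem hessianAux_const_aux (c : ℝ) (X Y : Π x : M, TangentSpace I x) (x : M) :
    g.hessianAux (fun _ : M ↦ c) X Y x = 0 := by
  have h1 : (fun y ↦ mvfderiv I (fun _ : M ↦ c) y (Y y)) = fun _ ↦ (0 : ℝ) := by
    funext y
    rw [mvfderiv_const_aux c y]
    rfl
  rw [PseudoRiemannianMetric.hessianAux, h1, mvfderiv_const_aux (0 : ℝ) x, mvfderiv_const_aux c x]
  simp

omit [Fact (1 ≤ n)] [FiniteDimensional ℝ E] in
/-- **The Hessian of a constant function vanishes** (`Hess c = ∇(dc) = 0`; O'Neill 1983, Ch. 3,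
Def. 3.48) — a private copy of `PseudoRiemannianMetric.hessian_const` of
`Lorentzian/BlackHoles.lean` (not imported here). [cite: ONeill1983, Ch. 3, Def. 3.48] -/
private theorem hessian_const_aux (c : ℝ) (x : M) : g.hessian (fun _ : M ↦ c) x = 0 := by
  have haux : ∀ X Y : Π x : M, TangentSpace I x, g.hessianAux (fun _ : M ↦ c) X Y x = 0 :=
    fun X Y ↦ hessianAux_const_aux g c X Y x
  unfold PseudoRiemannianMetric.hessian
  have hex : ∃ B : LinearMap.BilinForm ℝ (TangentSpace I x), ∀ X₀ Y₀ : TangentSpace I x,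
      B X₀ Y₀ = g.hessianAux (fun _ : M ↦ c) (FiberBundle.extend E X₀) (FiberBundle.extend E Y₀) x :=
    ⟨0, fun _ _ ↦ by simp [haux]⟩
  rw [dif_pos hex]
  ext X₀ Y₀
  simpa [haux] using hex.choose_spec X₀ Y₀

omit [Fact (1 ≤ n)] in
/-- **The Laplace–Beltrami operator kills constants**: `Δ_g c = tr_g Hess c = 0` (O'Neill 1983,
Ch. 3, Def. 3.50) — a private copy of `PseudoRiemannianMetric.dalembertian_const` of
`Lorentzian/BlackHoles.lean` (not imported here). [cite: ONeill1983, Ch. 3, Def. 3.50] -/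
private theorem dalembertian_const_aux (c : ℝ) (x : M) : g.dalembertian (fun _ : M ↦ c) x = 0 := by
  simp [PseudoRiemannianMetric.dalembertian, hessian_const_aux g c x, PseudoRiemannianMetric.trace]

end Const

/-! ### The `Q`-curvature and (1.11) -/

section QCurvature

variable {E : Type*} [NormedAddCommGroup E] [NormedSpace ℝ E] {H : Type*} [TopologicalSpace H]
  {I : ModelWithCorners ℝ E H} {M : Type*} [TopologicalSpace M] [ChartedSpace H M]
  [IsManifold I ∞ M] {n : ℕ∞ω} [Fact (1 ≤ n)]
  (g : PseudoRiemannianMetric I n E (TangentSpace I : M → Type _))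
  [FiniteDimensional ℝ E] [g.HasLeviCivita]

/-- **The `Q`-curvature of a Riemannian `4`-manifold** (Chang–Gursky–Yang 2003, p. 113: "`Q` is
the fourth order curvature invariant `Q = (1/12)(−ΔR + ¼R² − 3|E|²)`"; Branson's `Q`-curvature in
dimension four): `qCurvature g x = (1/12)(−Δ_g R_g (x) + ¼ R_g(x)² − 3|E_g|²(x))` with
`Δ_g = tr_g Hess` (`dalembertian`), `R_g` the scalar curvature and `|E|²` the squared norm of the
trace-free Ricci tensor (`tracelessRicciNormSq`). Meaningful for a `C²` Riemannian metric on a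
`4`-manifold. [cite: ChangGurskyYang2003, §1, p. 113] -/
def _root_.Literature.Geometry.Lorentzian.PseudoRiemannianMetric.qCurvature (x : M) : ℝ :=
  1 / 12 * (-(g.dalembertian g.scalarCurvature x) + 1 / 4 * g.scalarCurvature x ^ 2 -
    3 * g.tracelessRicciNormSq x)

omit [Fact (1 ≤ n)] in
/-- Unfolding of `qCurvature`. [cite: ChangGurskyYang2003, §1, p. 113] -/
theorem _root_.Literature.Geometry.Lorentzian.PseudoRiemannianMetric.qCurvature_def (x : M) :
    g.qCurvature x =
      1 / 12 * (-(g.dalembertian g.scalarCurvature x) + 1 / 4 * g.scalarCurvature x ^ 2 -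
        3 * g.tracelessRicciNormSq x) :=
  rfl

/-- **Chang–Gursky–Yang 2003, (1.11): `Q = ½ σ₂(A) + (1/12)(−ΔR)`**, pointwise for a `C²`
metric on a `4`-dimensional model at every point where `g_x` is positive definite
(`σ₂(A) = −½|E|² + R²/24`, `sigma2WeylSchouten_eq`). [cite: ChangGurskyYang2003, §1, (1.11)] -/
theorem _root_.Literature.Geometry.Lorentzian.PseudoRiemannianMetric.qCurvature_eq_sigma2WeylSchouten
    [CompleteSpace E] (hn : 2 ≤ n) (hE : finrank ℝ E = 4) {x : M}
    (hpos : ∀ v : TangentSpace I x, v ≠ 0 → 0 < g.val x v v) :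
    g.qCurvature x =
      1 / 2 * g.sigma2WeylSchouten x + 1 / 12 * (-(g.dalembertian g.scalarCurvature x)) := by
  rw [qCurvature, g.sigma2WeylSchouten_eq hn hE hpos]
  ring

variable {g} in
omit [Fact (1 ≤ n)] in
/-- **`Q = 3K²` for constant sectional curvature `K` in dimension `4`** (at positive definite
points of a metric whose scalar curvature is the constant `12K`, e.g. `K = 1` on the round unit
`S⁴`): `E = 0` (`HasConstantSectionalCurvatureWith.tracelessRicciNormSq_eq_zero`), `ΔR = 0`
(`Δ c = 0`), `Q = (1/12) · ¼ · (12K)² = 3K²`. [cite: ChangGurskyYang2003, §1, p. 113] -/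
theorem _root_.Literature.Geometry.Lorentzian.PseudoRiemannianMetric.HasConstantSectionalCurvatureWith.qCurvature_eq
    {K : ℝ} (h : g.HasConstantSectionalCurvatureWith g.leviCivita K)
    (hR : g.scalarCurvature = fun _ ↦ 12 * K) (x : M) : g.qCurvature x = 3 * K ^ 2 := by
  have hRx : g.scalarCurvature x = 12 * K := by rw [hR]
  have hΔ : g.dalembertian g.scalarCurvature x = 0 := by
    rw [hR]
    exact dalembertian_const_aux g (12 * K) x
  rw [qCurvature, h.tracelessRicciNormSq_eq_zero x, hΔ, hRx]
  ring

/-- **`Q` is continuous** for a `C^∞` Riemannian metric on a boundaryless `4`-dimensional model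
(`Δ_g R` is continuous, `continuous_dalembertian` with `R ∈ C^∞`, `contMDiff_scalarCurvature`;
`|E|²` is continuous, `continuous_tracelessRicciNormSq`). [cite: ChangGurskyYang2003, §1, p. 113] -/
theorem _root_.Literature.Geometry.Lorentzian.PseudoRiemannianMetric.continuous_qCurvature
    [CompleteSpace E] [I.Boundaryless]
    (g : PseudoRiemannianMetric I ∞ E (TangentSpace I : M → Type _)) [g.HasLeviCivita]
    (hg : g.IsRiemannian) (hE : finrank ℝ E = 4) : Continuous g.qCurvature := by
  have hR : Continuous g.scalarCurvature := g.contMDiff_scalarCurvature.continuous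
  have hR2 : ContMDiff I 𝓘(ℝ, ℝ) 2 g.scalarCurvature :=
    g.contMDiff_scalarCurvature.of_le (WithTop.coe_le_coe.mpr le_top)
  have hΔ : Continuous (g.dalembertian g.scalarCurvature) := continuous_dalembertian g hR2
  have hEc : Continuous g.tracelessRicciNormSq := g.continuous_tracelessRicciNormSq hg hE
  unfold qCurvature
  exact continuous_const.mul ((hΔ.neg.add (continuous_const.mul (hR.pow 2))).sub
    (continuous_const.mul hEc))

end QCurvature

/-! ### `∫_M Q dV = ½ ∫_M σ₂(A) dV` on a closed `4`-manifold, and Gauss–Bonnet in `Q`-form -/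

section Closed

open Literature.AlgebraicTopology.SingularHomology (relEuler)
open Literature.Topology.FourManifolds

variable {M : Type*} [TopologicalSpace M] [T2Space M] [ChartedSpace (EuclideanSpace ℝ (Fin 4)) M]
  [IsManifold (𝓡 4) ∞ M] [CompactSpace M] [MeasurableSpace M] [BorelSpace M]
  (g : PseudoRiemannianMetric (𝓡 4) ∞ (EuclideanSpace ℝ (Fin 4)) (TangentSpace (𝓡 4) : M → Type _))
  [g.HasLeviCivita]

/-- **`∫_M Q dV = ½ ∫_M σ₂(A) dV` on a closed Riemannian `4`-manifold** (Chang–Gursky–Yang 2003,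
(1.11) integrated: `∫ Q = ½ ∫ σ₂(A) − (1/12) ∫ ΔR` and `∫_M Δ_g R dV_g = 0` on a closed manifold —
Green's identity, `integral_dalembertian_eq_zero`, Lee 2018, Problem 2-23 (c)); here
`∫ σ₂(A) dV = sigma2WeylSchoutenIntegral` and `Q` is integrable (continuous on a compact manifold).
[cite: ChangGurskyYang2003, §1, (1.11)] [cite: Lee2018, Problem 2-23 (c)] -/
theorem _root_.Literature.Geometry.Lorentzian.PseudoRiemannianMetric.integral_qCurvature_eq
    (hg : g.IsRiemannian) :
    Integrable g.qCurvature (riemannianMeasure (g.toContMDiffRiemannianMetric hg)) ∧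
    ∫ x, g.qCurvature x ∂(riemannianMeasure (g.toContMDiffRiemannianMetric hg)) =
      1 / 2 * g.sigma2WeylSchoutenIntegral := by
  set G₀ := g.toContMDiffRiemannianMetric hg with hG₀
  haveI hLC : (ofRiemannian G₀).HasLeviCivita := ‹g.HasLeviCivita›
  have hE : finrank ℝ (EuclideanSpace ℝ (Fin 4)) = 4 := finrank_euclideanSpace_fin
  have hR2 : ContMDiff (𝓡 4) 𝓘(ℝ, ℝ) 2 g.scalarCurvature :=
    g.contMDiff_scalarCurvature.of_le (WithTop.coe_le_coe.mpr le_top)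
  have hΔc : Continuous (g.dalembertian g.scalarCurvature) := continuous_dalembertian g hR2
  have hσ : Integrable g.sigma2WeylSchouten (riemannianMeasure G₀) :=
    g.integrable_sigma2WeylSchouten hg hE
  have hΔi : Integrable (g.dalembertian g.scalarCurvature) (riemannianMeasure G₀) :=
    integrable_of_continuous G₀ hΔc
  have hptx : ∀ x, g.qCurvature x =
      1 / 2 * g.sigma2WeylSchouten x + 1 / 12 * (-(g.dalembertian g.scalarCurvature x)) :=
    fun x ↦ g.qCurvature_eq_sigma2WeylSchouten (WithTop.coe_le_coe.mpr le_top) hE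
      fun v hv ↦ hg x v hv
  have hpt : g.qCurvature = fun x ↦
      1 / 2 * g.sigma2WeylSchouten x + 1 / 12 * (-(g.dalembertian g.scalarCurvature x)) :=
    funext hptx
  have hΔi' : Integrable (fun x ↦ 1 / 12 * (-(g.dalembertian g.scalarCurvature x)))
      (riemannianMeasure G₀) :=
    hΔi.neg.const_mul (1 / 12)
  have hint : Integrable (fun x ↦
      1 / 2 * g.sigma2WeylSchouten x + 1 / 12 * (-(g.dalembertian g.scalarCurvature x)))
      (riemannianMeasure G₀) :=
    (hσ.const_mul _).add hΔi'
  have hGreen : ∫ x, g.dalembertian g.scalarCurvature x ∂(riemannianMeasure G₀) = 0 :=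
    integral_dalembertian_eq_zero G₀ hR2
  refine ⟨hpt ▸ hint, ?_⟩
  have hI : ∫ x, g.qCurvature x ∂(riemannianMeasure G₀) =
      ∫ x, (1 / 2 * g.sigma2WeylSchouten x + 1 / 12 * (-(g.dalembertian g.scalarCurvature x)))
        ∂(riemannianMeasure G₀) :=
    integral_congr_ae (ae_of_all _ hptx)
  rw [hI, integral_add (hσ.const_mul _) hΔi', integral_const_mul,
    integral_const_mul, integral_neg, hGreen, g.sigma2WeylSchoutenIntegral_eq hg]
  ring

/-- **The Chern–Gauss–Bonnet formula in `Q`-curvature form.** On a closed Riemannian `4`-manifold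
and for any real `χ`: `8π² χ = ¼ ∫|W|² dV + ∫ σ₂(A) dV` (the form (1.1) of Chang–Gursky–Yang 2003)
`↔ 4π² χ = ⅛ ∫|W|² dV + ∫ Q dV`, by `∫ Q = ½ ∫ σ₂(A)` (`integral_qCurvature_eq`).
[cite: ChangGurskyYang2003, §1, (1.1) and (1.11)] -/
theorem _root_.Literature.Geometry.Lorentzian.PseudoRiemannianMetric.chernGaussBonnet_iff_qCurvature
    (hg : g.IsRiemannian) (χ : ℝ) :
    8 * Real.pi ^ 2 * χ = 1 / 4 * g.weylEnergy.toReal + g.sigma2WeylSchoutenIntegral ↔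
      4 * Real.pi ^ 2 * χ = 1 / 8 * g.weylEnergy.toReal +
        ∫ x, g.qCurvature x ∂(riemannianMeasure (g.toContMDiffRiemannianMetric hg)) := by
  rw [(g.integral_qCurvature_eq hg).2]
  constructor <;> intro h <;> linarith

end Closed

/-! ### The round `S⁴`: `Q ≡ 3`, `∫ Q dV = 8π² = 4π² χ(S⁴)` -/

section RoundSphere

open Literature.AlgebraicTopology.SingularHomology (relEuler)
open Literature.Topology.FourManifolds
open Metric
-- Mathlib's scoped instance `Fact (finrank ℝ (EuclideanSpace ℝ (Fin n)) = n)` for `roundMetric`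
open scoped EuclideanSpace

/-- **`Q ≡ 3` on the round unit `S⁴`** (`K = 1`, `R ≡ 12`, `E = 0`, `ΔR = 0`).
[cite: ChangGurskyYang2003, §1, p. 113] [cite: Lee2018, Prop. 8.36] -/
theorem qCurvature_roundMetric_sphere_four (V : Type*) [NormedAddCommGroup V]
    [InnerProductSpace ℝ V] [Fact (finrank ℝ V = 4 + 1)] [(roundMetric (n := 4) V).HasLeviCivita]
    (x : sphere (0 : V) 1) : (roundMetric (n := 4) V).qCurvature x = 3 := by
  have hR : (roundMetric (n := 4) V).scalarCurvature = fun _ ↦ 12 * (1 : ℝ) := by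
    funext y
    rw [scalarCurvature_roundMetric V y]
    norm_num
  have h := (hasConstantSectionalCurvatureWith_roundMetric V
    (roundMetric (n := 4) V).isLeviCivita_leviCivita_holds).qCurvature_eq hR x
  rw [h]
  norm_num

/-- **`∫_{S⁴} Q dV = 8π² = 4π² χ(S⁴)`** for the round unit sphere (`Q ≡ 3`,
`Vol(S⁴) = 8π²/3`, `χ(S⁴) = relEuler ℤ ℤ S⁴ ∅ = 2`): the `Q`-form of the Gauss–Bonnet formula on
the model space, both sides computed in the tree. [cite: ChangGurskyYang2003, §1, (1.1) and (1.11)] -/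
theorem integral_qCurvature_roundMetric_sphere_four
    [(roundMetric (n := 4) (EuclideanSpace ℝ (Fin 5))).HasLeviCivita] :
    ∫ x, (roundMetric (n := 4) (EuclideanSpace ℝ (Fin 5))).qCurvature x
        ∂(riemannianMeasure ((roundMetric (n := 4) (EuclideanSpace ℝ (Fin 5))).toContMDiffRiemannianMetric
          isRiemannian_roundMetric)) =
      4 * Real.pi ^ 2 * (relEuler ℤ ℤ (sphere (0 : EuclideanSpace ℝ (Fin 5)) 1) ∅ : ℝ) := by
  have hχ : relEuler ℤ ℤ (sphere (0 : EuclideanSpace ℝ (Fin 5)) 1) ∅ = 2 :=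
    finRelHomology_sphere_four.2
  simp only [qCurvature_roundMetric_sphere_four, integral_const, smul_eq_mul, measureReal_def,
    toReal_riemannianMeasure_roundMetric_sphere_four_univ, hχ]
  push_cast
  ring

end RoundSphere

/-! ### Theorem A (vended special case) from Chern–Gauss–Bonnet in `Q`-curvature form -/

section Reduction

open Literature.AlgebraicTopology.SingularHomology (relEuler)
open Literature.Topology.FourManifolds

/-- **Chang–Gursky–Yang 2003, Theorem A (vended special case `changGurskyYang_sphere_four`) from
the Chern–Gauss–Bonnet formula in `Q`-CURVATURE FORM, Margerin's theorem and Thm. 1.4.**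
Hypothesis `hCGB`: for every closed smooth `4`-manifold `M` (any Borel structure) and every `C^∞`
Riemannian metric `g` on `TM` with its Levi-Civita connection,
`4π² χ(M) = ⅛ (∫_M |W_g|² dV_g) + ∫_M Q_g dV_g` (`χ(M) = relEuler ℤ ℤ M ∅`; the form in which the
Gauss–Bonnet integrand enters the functional `II` and the conformal invariant `κ` of §1, pp.
113–114, equivalent to (1.1) by (1.11) and `∫ ΔR = 0`, `chernGaussBonnet_iff_qCurvature`);
`hMargerin`, `hThm14` verbatim as in
`changGurskyYang_sphere_four_of_chernGaussBonnet_of_margerin_of_thm14` (`ChangGurskyYangEuler.lean`),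
which concludes. The three hypotheses are deep published theorems, not named facts of the tree.
[cite: ChangGurskyYang2003, §1, (1.1) and (1.11)] [cite: ChangGurskyYang2003, Thm. 1.4]
[cite: Margerin1998, Thm. 1] -/
theorem changGurskyYang_sphere_four_of_chernGaussBonnetQ_of_margerin_of_thm14
    (hCGB : ∀ (M : Type) [TopologicalSpace M] [T2Space M] [SecondCountableTopology M]
      [ChartedSpace (EuclideanSpace ℝ (Fin 4)) M] [IsManifold (𝓡 4) ∞ M] [CompactSpace M]
      [MeasurableSpace M] [BorelSpace M]
      (g : PseudoRiemannianMetric (𝓡 4) ∞ (EuclideanSpace ℝ (Fin 4)) (TangentSpace (𝓡 4) : M → Type _))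
      [g.HasLeviCivita] (hg : g.IsRiemannian),
      4 * Real.pi ^ 2 * (relEuler ℤ ℤ M ∅ : ℝ) = 1 / 8 * g.weylEnergy.toReal +
        ∫ x, g.qCurvature x ∂(riemannianMeasure (g.toContMDiffRiemannianMetric hg)))
    (hMargerin : ∀ (M : Type) [TopologicalSpace M] [T2Space M] [SecondCountableTopology M]
      [ChartedSpace (EuclideanSpace ℝ (Fin 4)) M] [IsManifold (𝓡 4) ∞ M] [CompactSpace M]
      [ConnectedSpace M]
      (g : PseudoRiemannianMetric (𝓡 4) ∞ (EuclideanSpace ℝ (Fin 4)) (TangentSpace (𝓡 4) : M → Type _))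
      [g.HasLeviCivita], g.IsRiemannian → (∀ x, 0 < g.scalarCurvature x) →
      (∀ x, g.weakPinching x < 1 / 6) →
      Nonempty (M ≃ₘ⟮𝓡 4, 𝓡 4⟯ Metric.sphere (0 : EuclideanSpace ℝ (Fin 5)) 1) ∨
        IsRealProjectiveSpace 4 M)
    (hThm14 : ∀ (M : Type) [TopologicalSpace M] [T2Space M] [SecondCountableTopology M]
      [ChartedSpace (EuclideanSpace ℝ (Fin 4)) M] [IsManifold (𝓡 4) ∞ M] [CompactSpace M]
      [MeasurableSpace M] [BorelSpace M]
      (g₀ : PseudoRiemannianMetric (𝓡 4) ∞ (EuclideanSpace ℝ (Fin 4)) (TangentSpace (𝓡 4) : M → Type _))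
      [g₀.HasLeviCivita] (hg₀ : g₀.IsRiemannian),
      0 < yamabeConstant (g₀.toContMDiffRiemannianMetric hg₀) →
      1 / 4 * g₀.weylEnergy.toReal < g₀.sigma2WeylSchoutenIntegral →
      ∃ (g : PseudoRiemannianMetric (𝓡 4) ∞ (EuclideanSpace ℝ (Fin 4)) (TangentSpace (𝓡 4) : M → Type _))
        (_ : g.HasLeviCivita) (hg : g.IsRiemannian),
        IsConformalTo (g.toContMDiffRiemannianMetric hg) (g₀.toContMDiffRiemannianMetric hg₀) ∧
        ∀ x, 1 / 4 * g.weylNormSq x < g.sigma2WeylSchouten x) :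
    changGurskyYang_sphere_four := by
  refine changGurskyYang_sphere_four_of_chernGaussBonnet_of_margerin_of_thm14 ?_ hMargerin hThm14
  intro M _ _ _ _ _ _ g _ hg
  letI : MeasurableSpace M := borel M
  haveI : BorelSpace M := ⟨rfl⟩
  exact (g.chernGaussBonnet_iff_qCurvature hg _).2 (hCGB M g hg)

end Reduction

/-! ### The constants of the proof of Thm. 1.4: `κ = 0` (Chang–Gursky–Yang 2003, pp. 114–116) -/

section Kappa

variable {M : Type*} [TopologicalSpace M] [T2Space M] [ChartedSpace (EuclideanSpace ℝ (Fin 4)) M]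
  [IsManifold (𝓡 4) ∞ M] [CompactSpace M] [MeasurableSpace M] [BorelSpace M]
  (g : PseudoRiemannianMetric (𝓡 4) ∞ (EuclideanSpace ℝ (Fin 4)) (TangentSpace (𝓡 4) : M → Type _))
  [g.HasLeviCivita]

/-- **"With these values of `(γ̃₁, γ₁, γ₂, γ₃)`, the conformal invariant `κ` defined in (1.12) is
equal to zero"** (Chang–Gursky–Yang 2003, p. 116, first step of the proof of Thm. 1.4). With
`κ = γ̃₁ ∫|η|₀² dv₀ + γ₁ ∫|W₀|² dv₀ + γ₂ ∫Q₀ dv₀` ((1.12), p. 114) and the choice (p. 115)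
`γ̃₁ = −½ (∫σ₂(A₀) dv₀ − (α/4)∫|W₀|² dv₀) / ∫|η|₀² dv₀`, `γ₁ = −α/8`, `γ₂ = 1` (any `γ₃`), on a
closed Riemannian `4`-manifold: `κ = 0` — because `∫ Q dV = ½ ∫ σ₂(A) dV`
(`integral_qCurvature_eq`, (1.11) with `∫ΔR = 0`). Here `∫|W₀|² dv₀ = weylEnergy.toReal`,
`∫σ₂(A₀) dv₀ = sigma2WeylSchoutenIntegral`, and `Iη = ∫|η|₀² dv₀ ≠ 0` is any nonzero real (the
`η`-energy of the nowhere-vanishing auxiliary tensor `η`). [cite: ChangGurskyYang2003, §1, (1.12) and p. 116] -/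
theorem _root_.Literature.Geometry.Lorentzian.PseudoRiemannianMetric.changGurskyYang_kappa_eq_zero
    (hg : g.IsRiemannian) (α : ℝ) {Iη : ℝ} (hIη : Iη ≠ 0) :
    (-(1 / 2) * (g.sigma2WeylSchoutenIntegral - α / 4 * g.weylEnergy.toReal) / Iη) * Iη +
        (-(α / 8)) * g.weylEnergy.toReal +
        1 * ∫ x, g.qCurvature x ∂(riemannianMeasure (g.toContMDiffRiemannianMetric hg)) = 0 := by
  rw [(g.integral_qCurvature_eq hg).2]
  field_simp
  ring

/-- Hence **the hypothesis `κ < γ₂ 8π²` of Thm. 1.5 holds** for this choice (`κ = 0 < 8π²`,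
`γ₂ = 1`; Chang–Gursky–Yang 2003, p. 116: "Thus, as long as `γ₃ > 0` (i.e., `δ > 2/3`) the
hypotheses of Theorem 1.5 hold"). [cite: ChangGurskyYang2003, §1, Thm. 1.5 and p. 116] -/
theorem _root_.Literature.Geometry.Lorentzian.PseudoRiemannianMetric.changGurskyYang_kappa_lt
    (hg : g.IsRiemannian) (α : ℝ) {Iη : ℝ} (hIη : Iη ≠ 0) :
    (-(1 / 2) * (g.sigma2WeylSchoutenIntegral - α / 4 * g.weylEnergy.toReal) / Iη) * Iη +
        (-(α / 8)) * g.weylEnergy.toReal +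
        1 * ∫ x, g.qCurvature x ∂(riemannianMeasure (g.toContMDiffRiemannianMetric hg)) <
      1 * (8 * Real.pi ^ 2) := by
  rw [g.changGurskyYang_kappa_eq_zero hg α hIη]
  positivity

end Kappa

end Literature.Geometry.Riemannian

end
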